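import Summits.CriticalPhenomena.PercolationContinuityZ3.Theorems.Transplant.FKConnectivityAllQForestAdjacentCutVertex
import HarnessLib

/-!
# Forest factorisation across a TWO-point interface (the forest case of the series–parallel / 2-sum calculus), by counting

Support file (`--supports stmt-CriticalPhenomena-4575`), FK sub-lane `prim-bschramm-fk-1` (gen 18) of the post-continuity programme;
builds on p205010 (kernel theorem, internal audit signed; external expert review pending).  No definitions, no named facts, no sorries;
standard axioms.

If the pairs of `E₁` live on `V₁`, those of `E₂` on `V₂`, `V₁ ∩ V₂ ⊆ {s, t}` (`s ≠ t`) and `E₁ ∩ E₂ = ∅`, then for `ω₁ ⊆ E₁`, `ω₂ ⊆ E₂`: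
**`isForestCfg_union_iff_of_twoSep`**: `ω₁ ∪ ω₂ ∈ Fo ↔ ω₁ ∈ Fo ∧ ω₂ ∈ Fo ∧ ¬ (s ~ t in ω₁ ∧ s ~ t in ω₂)` — a union of forests of the two
parts of a 2-separation is a forest unless both parts join the separators (then the two `s–t` paths close a cycle).  Proof by COUNTING, as for
the one-point interface (`isForestCfg_union_iff_of_cutVertex`, `…ForestAdjacentCutVertex.lean`): `ω ∈ Fo ↔ |ω| + k(ω) = |V|` (g16's
`isForestCfg_iff_ncard_add`), `|V| ≤ |ω| + k(ω)` always (`ncard_add_clusterCount_ge`), and fk-2 g7's parallel cluster-count identity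
`k(ω₁ ∪ ω₂) + |V| = k(ω₁) + k(ω₂) + 1{s ~ t in both}` (`clusterCount_parallel`, `…SPGluing.lean`).  Also the one-configuration form
**`isForestCfg_iff_inter_of_twoSep`** (`X ⊆ E₁ ∪ E₂` split as `(X ∩ E₁) ∪ (X ∩ E₂)`).
This is `F(G₁ ⊕₂ G₂) = F₁F₂ − C₁C₂` at the level of configurations — the input of the two 2-sum identities for the forest Rayleigh difference
(memo bschramm/FROM-fk-1-g18-VERTEX-NC.md §4b: `Δ_{e,f}(G₁ ⊕₂ G₂) = Δ_{e,h}(G₁+h)·Δ_{f,h}(G₂+h)` across the separation, and the same-side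
substitution formula), hence of "a minimal counterexample to the square-free adjacent forest Rayleigh node is 3-connected".
[cite: Grimmett2006, §1.5 (p. 13); §3.8 (pp. 61–62)] [cite: Wagner2006, Thm. 5.8, §5.3 (pp. 14–15)] [cite: SempleWelsh2008, Prop. 4.1 (p. 11)]
-/

noncomputable section

namespace Summit.CriticalPhenomena.PercolationContinuityZ3.Theorems

namespace FK

open Set Literature.Probability.LatticeModels Literature.Probability.Percolation
open scoped Classical

variable {V : Type*} [Fintype V]

/-- **`|V| ≤ |ω| + k(ω)`** for every configuration. [cite: Grimmett2006, §1.5 (p. 13)] -/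
theorem ncard_add_clusterCount_ge (ω : BondConfig V) : Fintype.card V ≤ ω.ncard + clusterCount ω ∅ := by
  have h := (card_le_card_add_clusterCount_and_iff (Set.toFinite ω).toFinset).1
  rw [Set.Finite.coe_toFinset, ← Set.ncard_eq_toFinset_card ω (Set.toFinite ω)] at h
  exact h

variable {E₁ E₂ : Set (Sym2 V)} {V₁ V₂ : Set V} {s t : V}

/-- **Forest factorisation across a two-point interface**: with the pairs of `E₁` on `V₁`, those of `E₂` on `V₂`, `V₁ ∩ V₂ ⊆ {s, t}`,
`s ≠ t`, and `E₁, E₂` disjoint, a union `ω₁ ∪ ω₂` (`ω_i ⊆ E_i`) is a forest configuration iff both parts are and not both join `s` to `t`.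
[cite: Grimmett2006, §3.8 (pp. 61–62)] [cite: Wagner2006, Thm. 5.8, §5.3 (pp. 14–15)] -/
theorem isForestCfg_union_iff_of_twoSep (h₁ : ∀ e ∈ E₁, ∀ z ∈ e, z ∈ V₁) (h₂ : ∀ e ∈ E₂, ∀ z ∈ e, z ∈ V₂) (hS : V₁ ∩ V₂ ⊆ {s, t})
    (hst : s ≠ t) (hd : Disjoint E₁ E₂) {ω₁ ω₂ : BondConfig V} (hω₁ : ω₁ ⊆ E₁) (hω₂ : ω₂ ⊆ E₂) :
    IsForestCfg (ω₁ ∪ ω₂) ↔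
      IsForestCfg ω₁ ∧ IsForestCfg ω₂ ∧ ¬ ((openGraph ω₁).Reachable s t ∧ (openGraph ω₂).Reachable s t) := by
  have hdisj : Disjoint ω₁ ω₂ := Set.disjoint_of_subset hω₁ hω₂ hd
  have hk := clusterCount_parallel h₁ h₂ hS hω₁ hω₂ hst
  have hge₁ := ncard_add_clusterCount_ge ω₁
  have hge₂ := ncard_add_clusterCount_ge ω₂
  have hcard : (ω₁ ∪ ω₂).ncard = ω₁.ncard + ω₂.ncard := Set.ncard_union_eq hdisj
  rw [isForestCfg_iff_ncard_add, isForestCfg_iff_ncard_add, isForestCfg_iff_ncard_add, hcard]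
  by_cases hboth : (openGraph ω₁).Reachable s t ∧ (openGraph ω₂).Reachable s t
  · rw [if_pos hboth] at hk
    constructor
    · intro h; omega
    · rintro ⟨-, -, h⟩; exact absurd hboth h
  · rw [if_neg hboth] at hk
    constructor
    · intro h; exact ⟨by omega, by omega, hboth⟩
    · rintro ⟨hF₁, hF₂, -⟩; omega

/-- The same for one configuration `X ⊆ E₁ ∪ E₂`, split as `(X ∩ E₁) ∪ (X ∩ E₂)`. [cite: Grimmett2006, §3.8 (pp. 61–62)] -/
theorem isForestCfg_iff_inter_of_twoSep (h₁ : ∀ e ∈ E₁, ∀ z ∈ e, z ∈ V₁) (h₂ : ∀ e ∈ E₂, ∀ z ∈ e, z ∈ V₂) (hS : V₁ ∩ V₂ ⊆ {s, t})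
    (hst : s ≠ t) (hd : Disjoint E₁ E₂) {X : BondConfig V} (hX : X ⊆ E₁ ∪ E₂) :
    IsForestCfg X ↔ IsForestCfg (X ∩ E₁) ∧ IsForestCfg (X ∩ E₂) ∧
      ¬ ((openGraph (X ∩ E₁)).Reachable s t ∧ (openGraph (X ∩ E₂)).Reachable s t) := by
  have hsplit : X = (X ∩ E₁) ∪ (X ∩ E₂) := by
    rw [← inter_union_distrib_left, inter_eq_self_of_subset_left hX]
  conv_lhs => rw [hsplit]
  exact isForestCfg_union_iff_of_twoSep h₁ h₂ hS hst hd inter_subset_right inter_subset_right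

end FK

end Summit.CriticalPhenomena.PercolationContinuityZ3.Theorems

end
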